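import Summits.AtomisticToContinuum.BoseEinsteinCondensation.Theses.BECThomsonPrinciple
import Literature.MathematicalPhysics.QuantumManyBody.GroundStateDirichletForm
import Literature.MathematicalPhysics.QuantumManyBody.PeriodicBoseGasMomentumSector

/-!
# Sketch — crux idea `fsum-over-landau-floor` (crux `DensityResponse`, stmt-AtomisticToContinuum-9481)

First lemmas of the line "f-sum numerator over the linear sector floor (squared)":

* `floor_mul_structureFactor_le` — `ω_Ψ(k) · ‖ρ_k‖²_Ψ ≤ N|k|²` (m₀ ≤ m₁/ω: a sector floor IS a
  structure-factor bound, via the exact f-sum numerator; PROVED here from the tree API);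
* `fsum_over_floor_sq` — `ω_Ψ(k)² · |⟨ρ_k, F⟩_Ψ|² ≤ N|k|² · E_Ψ(F)` for every Bloch-`k` test `F`
  (m₋₁ ≤ m₁/ω² in variational form: with `Ψ = Ψ₀` and the ground-state transform this is
  `χ(k) ≤ 4N|k|²/ω(k)²`, the `s → 0` core of the crux; statement only);
* the two spectral HYPOTHESES of the transfer, typed: `LandauFloor` (linear floor of the sector
  bottoms of `H`, all sectors, min-form) and `OneModeFloor` (the same floor at the single sector `k`
  for the one-mode-weakened Hamiltonian `H − (g/L³)(|ρ_k|² − N)`), and the fluctuation inequality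
  `FluctuationBound` they are used to derive;
* `densityResponse_of_floors` — the transfer target (statement only).
-/

noncomputable section

open MeasureTheory
open scoped ENNReal NNReal ComplexConjugate

namespace Summit.AtomisticToContinuum.BoseEinsteinCondensation.Cruxes.DensityResponse.FsumFloor

open Literature.MathematicalPhysics.QuantumManyBody.BoseGas

variable {N : ℕ} {L : ℝ}

/-- **A sector floor is a structure-factor bound** (`m₀ ≤ m₁/ω`): for every normalised periodic
state `Ψ` (as weight) and every dual-lattice `k = 2πn/L`,
`ω_Ψ(k) · ‖ρ_k‖²_Ψ ≤ N |k|²` — the sectorial Poincaré inequality applied to Feynman's density wave,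
whose Dirichlet energy is the exact f-sum numerator `N|k|²`. With `Ψ = Ψ₀`:
`S(k) = ‖ρ_k‖²_{Ψ₀}/N ≤ |k|²/ω(k)`. -/
theorem floor_mul_structureFactor_le (hL : 0 < L) (Ψ : PeriodicTrialState N L) (n : Fin 3 → ℤ) :
    sectorPoincareConstant L Ψ.ψ (latticeVec (2 * Real.pi / L) n) *
        weightedNormSq L Ψ.ψ (planeWaveSum L n) ≤
      N * (‖latticeVec (2 * Real.pi / L) n‖₊ : ℝ≥0∞) ^ 2 := by
  have ht : weightedNormSq L Ψ.ψ (planeWaveSum L n) ≠ ⊤ :=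
    ne_top_of_le_ne_top
      (by rw [Ψ.norm_eq, mul_one]; exact ENNReal.pow_ne_top (ENNReal.natCast_ne_top N))
      (weightedNormSq_planeWaveSum_le L Ψ.ψ n)
  have h := sectorPoincareConstant_mul_weightedNormSq_le (Ψ := Ψ.ψ)
    (isBlochTest_planeWaveSum (N := N) hL.ne' n) ht
  rwa [groundStateDirichletForm_planeWaveSum, Ψ.norm_eq, mul_one] at h

/-- The weighted pairing `⟨ρ_k, F⟩_Ψ = ∫_{cell} conj(ρ_k(X)) F(X) |Ψ(X)|² dX` (Bochner, in `ℂ`). -/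
def weightedPairing (L : ℝ) (Ψ F : Config N → ℂ) (n : Fin 3 → ℤ) : ℂ :=
  ∫ X in cellN N L, conj (planeWaveSum L n X) * F X * ((‖Ψ X‖ ^ 2 : ℝ) : ℂ)

/-- **f-sum over the floor, squared** (`m₋₁ ≤ m₁/ω²`, variational form): for every normalised
periodic weight `Ψ`, dual-lattice `k = 2πn/L` and Bloch-`k` test function `F`,
`ω_Ψ(k)² · |⟨ρ_k, F⟩_Ψ|² ≤ N|k|² · E_Ψ(F)`.
Proof plan: Cauchy–Schwarz `|⟨ρ_k,F⟩_Ψ|² ≤ ‖ρ_k‖²_Ψ ‖F‖²_Ψ`, then the Poincaré inequality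
`ω‖G‖²_Ψ ≤ E_Ψ(G)` for BOTH `G = ρ_k` (`floor_mul_structureFactor_le`) and `G = F`.
With `Ψ = Ψ₀` (ground-state transform: `E_{Ψ₀}(F) = ⟨FΨ₀,(H−E₀)FΨ₀⟩`, `ω_{Ψ₀}(k) = ε(k)`) this is
`sup_F (2Re⟨V_kΨ₀, FΨ₀⟩ − ⟨FΨ₀,(H−E₀)FΨ₀⟩) ≤ m₁/ω(k)²`, i.e. `χ(k) ≤ 4N|k|²/ω(k)²`. -/
theorem fsum_over_floor_sq (hL : 0 < L) (Ψ : PeriodicTrialState N L) (n : Fin 3 → ℤ)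
    {F : Config N → ℂ} (hF : IsBlochTest L (latticeVec (2 * Real.pi / L) n) F) :
    sectorPoincareConstant L Ψ.ψ (latticeVec (2 * Real.pi / L) n) ^ 2 *
        (‖weightedPairing L Ψ.ψ F n‖₊ : ℝ≥0∞) ^ 2 ≤
      N * (‖latticeVec (2 * Real.pi / L) n‖₊ : ℝ≥0∞) ^ 2 * groundStateDirichletForm L Ψ.ψ F := by
  sorry

/-! ### The two spectral hypotheses of the transfer -/

/-- **Linear Landau floor, min-form, all sectors** (hypothesis H1): for `N ≥ N₀`, `0 < L`,
`N ≤ ρ₀L³` (`ρ = N/L³`) and every `k ≠ 0`,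
`E₀^per(N,L) + θ √(ρ a) · min(|k|, M√ρ) ≤ inf {⟨Ψ,HΨ⟩ : Ψ Bloch-k}` (`= momentumSectorEnergy`,
`⊤` off the dual lattice, so only `k ∈ (2π/L)ℤ³` bind). On `|k| ≤ M√ρ` this is the linear yrast floor
(Landau's criterion, slope `θ√(ρa)` ≍ sound velocity); beyond the window it only asks that no sector
returns below the level reached at the window edge. -/
def LandauFloor (v : ℝ → ℝ≥0∞) (M θ ρ₀ : ℝ) (N₀ : ℕ) : Prop :=
  ∀ N : ℕ, N₀ ≤ N → ∀ L : ℝ, 0 < L → (N : ℝ) ≤ ρ₀ * L ^ 3 → ∀ k : Space, k ≠ 0 →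
    periodicGroundStateEnergy v N L +
        ENNReal.ofReal (θ * Real.sqrt (N / L ^ 3 * (scatteringLength v).toReal) *
          min ‖k‖ (M * Real.sqrt (N / L ^ 3))) ≤
      momentumSectorEnergy v N L k

/-- The energy of the **one-mode-weakened Hamiltonian** `H'_g = H − (g/L³)(|ρ_k|² − N)` at a finite-energy
periodic state (real-valued; `k = 2πn/L`): `E_v(Φ) − (g/L³)(‖ρ_kΦ‖² − N)`. -/
def oneModeEnergy (v : ℝ → ℝ≥0∞) (g : ℝ) (n : Fin 3 → ℤ) (Φ : PeriodicTrialState N L) : ℝ :=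
  (periodicEnergy v Φ).toReal - g / L ^ 3 * ((weightedNormSq L Φ.ψ (planeWaveSum L n)).toReal - N)

/-- Ground-state energy of `H'_g` (infimum over finite-energy periodic states). -/
def oneModeGroundStateEnergy (v : ℝ → ℝ≥0∞) (g : ℝ) (N : ℕ) (L : ℝ) (n : Fin 3 → ℤ) : ℝ :=
  sInf {e : ℝ | ∃ Φ : PeriodicTrialState N L, periodicEnergy v Φ ≠ ⊤ ∧ oneModeEnergy v g n Φ = e}

/-- Bottom of `H'_g` in the total-momentum sector `k` (infimum over finite-energy Bloch-`k` states). -/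
def oneModeSectorEnergy (v : ℝ → ℝ≥0∞) (g : ℝ) (N : ℕ) (L : ℝ) (n : Fin 3 → ℤ) (k : Space) : ℝ :=
  sInf {e : ℝ | ∃ Φ : PeriodicTrialState N L, periodicEnergy v Φ ≠ ⊤ ∧ HasTotalMomentum k Φ.ψ ∧
    oneModeEnergy v g n Φ = e}

/-- **One-mode floor** (hypothesis H2): the linear floor at the single sector `k` survives weakening the
`k`-th Fourier mode of the repulsion by the subcritical Kac coupling `g = κ_k L³/(C₂ N)`,
`κ_k = |k|² + ρ a`: `inf_{sector k} H'_g − inf H'_g ≥ θ' √(ρa) |k|` on the window. -/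
def OneModeFloor (v : ℝ → ℝ≥0∞) (M C₂ θ' ρ₀ : ℝ) (N₀ : ℕ) : Prop :=
  ∀ N : ℕ, N₀ ≤ N → ∀ L : ℝ, 0 < L → (N : ℝ) ≤ ρ₀ * L ^ 3 → ∀ n : Fin 3 → ℤ, n ≠ 0 →
    ‖latticeVec (2 * Real.pi / L) n‖ ≤ M * Real.sqrt (N / L ^ 3) →
    let a : ℝ := (scatteringLength v).toReal
    let κ : ℝ := ‖latticeVec (2 * Real.pi / L) n‖ ^ 2 + N / L ^ 3 * a
    let g : ℝ := κ * L ^ 3 / (C₂ * N)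
    oneModeGroundStateEnergy v g N L n + θ' * Real.sqrt (N / L ^ 3 * a) * ‖latticeVec (2 * Real.pi / L) n‖ ≤
      oneModeSectorEnergy v g N L n (latticeVec (2 * Real.pi / L) n)

/-- **Fluctuation inequality** (derived from H2 + f-sum + variational principle): every periodic state has
`‖ρ_kΦ‖² ≤ N (β₀ |k|/√(ρa) + β₁ (E_v(Φ) − E₀)/κ_k)` — zero-point level plus `β₁/κ_k` per unit of excess energy. -/
def FluctuationBound (v : ℝ → ℝ≥0∞) (M β₀ β₁ ρ₀ : ℝ) (N₀ : ℕ) : Prop :=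
  ∀ N : ℕ, N₀ ≤ N → ∀ L : ℝ, 0 < L → (N : ℝ) ≤ ρ₀ * L ^ 3 → ∀ n : Fin 3 → ℤ, n ≠ 0 →
    ‖latticeVec (2 * Real.pi / L) n‖ ≤ M * Real.sqrt (N / L ^ 3) → ∀ Φ : PeriodicTrialState N L,
    let a : ℝ := (scatteringLength v).toReal
    let k : ℝ := ‖latticeVec (2 * Real.pi / L) n‖
    let κ : ℝ := k ^ 2 + N / L ^ 3 * a
    weightedNormSq L Φ.ψ (planeWaveSum L n) ≤
      ENNReal.ofReal (N * β₀ * k / Real.sqrt (N / L ^ 3 * a)) +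
        ENNReal.ofReal (N * β₁ / κ) * (periodicEnergy v Φ - periodicGroundStateEnergy v N L)

/-- `FluctuationBound` from `OneModeFloor` (f-sum for the ground state of `H'_g` + variational principle;
bounded `v` first, hard cores by truncation). Statement only. -/
theorem fluctuationBound_of_oneModeFloor (v : ℝ → ℝ≥0∞) (hv : IsRepulsiveFiniteRange v)
    (ha : (scatteringLength v).toReal ≠ 0) {M C₂ θ' ρ₀ : ℝ} {N₀ : ℕ} (hM : 0 < M) (hC : 0 < C₂)
    (hθ : 0 < θ') (h : OneModeFloor v M C₂ θ' ρ₀ N₀) :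
    FluctuationBound v M (1 / θ') C₂ ρ₀ N₀ := by
  sorry

/-- **The transfer** (target of the line): the two floors imply the crux instance `(v, M)` with an explicit
constant `C = C(θ, θ', C₂, M, a)`; `a(v) = 0` (`v = 0` a.e.) is the free case, already in tree
(`holds_free_four`). Statement only — the proof is the spectral bootstrap of the card
(no-soft-pairs vanishing below `θ√(ρa)|k|/4`, cross term by `(H−E₀)⁻¹P_> ≤ (H−E₀)/Ω₀²` and the f-sum,
high-energy states by `FluctuationBound`). -/
theorem densityResponse_of_floors
    (hfloor : ∀ v : ℝ → ℝ≥0∞, IsRepulsiveFiniteRange v → (scatteringLength v).toReal ≠ 0 →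
      ∀ M : ℝ, 0 < M → ∃ θ ρ₀ : ℝ, 0 < θ ∧ 0 < ρ₀ ∧ ∃ N₀ : ℕ, LandauFloor v M θ ρ₀ N₀)
    (hone : ∀ v : ℝ → ℝ≥0∞, IsRepulsiveFiniteRange v → (scatteringLength v).toReal ≠ 0 →
      ∀ M : ℝ, 0 < M → ∃ C₂ θ' ρ₀ : ℝ, 0 < C₂ ∧ 0 < θ' ∧ 0 < ρ₀ ∧ ∃ N₀ : ℕ, OneModeFloor v M C₂ θ' ρ₀ N₀) :
    Summit.AtomisticToContinuum.BoseEinsteinCondensation.Theses.BECThomsonPrinciple.DensityResponse := by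
  sorry

end Summit.AtomisticToContinuum.BoseEinsteinCondensation.Cruxes.DensityResponse.FsumFloor
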